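import Literature.MathematicalPhysics.QuantumLattice.FermionicTreeExpansionBounds
import Literature.Analysis.InnerProduct.GramHadamard
import HarnessLib

/-!
# Propagators in Gram form satisfy the determinant bound

Topic `Literature/MathematicalPhysics/QuantumLattice`; a small junction between the two forms of the
fermionic tree estimates of this directory.  `FermionicTreeExpansionTrees/Decay.lean` bound the truncated
expectation for propagators in GRAM FORM `G f f' = ⟪A f, B f'⟫` (unit Gram vectors), while
`FermionicTreeExpansionDetBound(Decay).lean`, `FermionicTreeExpansionFieldLines.lean` and
`FermionicTreeExpansionKernelDecay.lean` (extended vertices) take as hypothesis a DETERMINANT BOUND: every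
Gram-weighted minor `det [⟨w_a, w_b⟩ G(e ρ a)(e γ b)]`, `‖w‖ = 1`, has `‖det‖ ≤ δ^{size}`.  By the
Gram–Hadamard inequality a propagator in Gram form with `‖A f‖ ≤ a`, `‖B f‖ ≤ b` satisfies the determinant
bound with `δ = max 1 (a b)` (Benfatto–Giuliani–Mastropietro 2006, (2.80); Mastropietro 2008, Lemma 2.2):
the weighted entry `⟨w_a, w_b⟩ ⟪A, B⟫` is the inner product of the tensor vectors `w_a ⊗ A`, `w_b ⊗ B`
(`FermionicTree.tens`, `inner_tens`, `norm_tens`).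

* **`FermionicTree.detBound_of_gramProp`** — the determinant-bound hypothesis `hDB` of the files above for
  `gramProp 𝕜 A B`, with `δ = max 1 (a b)`.

Everything is proved; no named fact.

## Sources

G. Benfatto, A. Giuliani, V. Mastropietro, Ann. Henri Poincaré 7 (2006) 809–898, (2.80)
(`BenfattoGiulianiMastropietro2006`); V. Mastropietro, *Non-Perturbative Renormalization* (2008),
Lemma 2.2 (`Mastropietro2008`).
-/

noncomputable section

open Finset Matrix Literature.Analysis.InnerProduct
open scoped InnerProductSpace

namespace Literature.MathematicalPhysics.QuantumLattice

namespace FermionicTree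

variable {𝕜 : Type*} [RCLike 𝕜] {E : Type*} [NormedAddCommGroup E] [InnerProductSpace 𝕜 E]
variable {F : Type*}

/-- **A propagator in Gram form satisfies the determinant bound** (Gram–Hadamard; Benfatto–Giuliani–
Mastropietro 2006, (2.80)): if `G f f' = ⟪A f, B f'⟫` with `‖A f‖ ≤ a` and `‖B f‖ ≤ b`, then every
Gram-weighted minor `det [⟨w_p, w_q⟩ G(e ρ p)(e γ q)]` with unit real weight vectors `w` has
`‖det‖ ≤ (max 1 (a b))^{size}` — the hypothesis `hDB` of `FermionicTreeExpansionDetBound.lean`,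
`…DetBoundDecay.lean`, `…FieldLines.lean`, `…KernelDecay.lean`. [cite: BenfattoGiulianiMastropietro2006, (2.80)] -/
theorem detBound_of_gramProp (A B : F → E) {a b : ℝ} (ha0 : 0 ≤ a) (hb0 : 0 ≤ b) (hA : ∀ f, ‖A f‖ ≤ a)
    (hB : ∀ f, ‖B f‖ ≤ b) (m r : ℕ) (w : Fin r → EuclideanSpace ℝ (Fin m)) (hw : ∀ p, ‖w p‖ = 1)
    (e : Fin r → F) (c' : ℕ) (ρ γ : Fin c' → Fin r) :
    ‖(Matrix.of fun p q : Fin c' =>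
        ((⟪w (ρ p), w (γ q)⟫_ℝ : ℝ) : 𝕜) * gramProp 𝕜 A B (e (ρ p)) (e (γ q))).det‖ ≤ (max 1 (a * b)) ^ c' := by
  -- the weighted entries are inner products of tensor vectors
  have hentry : (Matrix.of fun p q : Fin c' =>
      ((⟪w (ρ p), w (γ q)⟫_ℝ : ℝ) : 𝕜) * gramProp 𝕜 A B (e (ρ p)) (e (γ q))) =
      Matrix.of fun p q : Fin c' => ⟪tens 𝕜 (w (ρ p)) (A (e (ρ p))), tens 𝕜 (w (γ q)) (B (e (γ q)))⟫_𝕜 := by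
    ext p q
    simp only [Matrix.of_apply, gramProp, inner_tens]
  rw [hentry]
  refine (norm_det_inner_le_prod_norm_mul_prod_norm _ _).trans ?_
  have hab : a * b ≤ max 1 (a * b) := le_max_right _ _
  calc (∏ p, ‖tens 𝕜 (w (ρ p)) (A (e (ρ p)))‖) * ∏ q, ‖tens 𝕜 (w (γ q)) (B (e (γ q)))‖
      ≤ (∏ _p : Fin c', a) * ∏ _q : Fin c', b := by
        refine mul_le_mul (prod_le_prod (fun _ _ => norm_nonneg _) fun p _ => ?_)
          (prod_le_prod (fun _ _ => norm_nonneg _) fun q _ => ?_)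
          (prod_nonneg fun _ _ => norm_nonneg _) (prod_nonneg fun _ _ => ha0)
        · rw [norm_tens, hw, one_mul]; exact hA _
        · rw [norm_tens, hw, one_mul]; exact hB _
    _ = (a * b) ^ c' := by rw [prod_const, prod_const, card_univ, Fintype.card_fin, ← mul_pow]
    _ ≤ (max 1 (a * b)) ^ c' := pow_le_pow_left₀ (mul_nonneg ha0 hb0) hab c'

/-- The determinant-bound constant of a Gram-form propagator is at least one. [folklore] -/
theorem one_le_max_one_mul (a b : ℝ) : (1 : ℝ) ≤ max 1 (a * b) := le_max_left _ _

end FermionicTree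

end Literature.MathematicalPhysics.QuantumLattice
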